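import Literature.AnabelianGeometry.EtaleTheta.SettingModelTateInstance
import Literature.AnabelianGeometry.EtaleTheta.SettingModelTateThetaOddShear
import HarnessLib

/-!
# The stage-2 model of the [EtTh] §1 root: its covering fields `K_N` ARE the division fields
# `ℚ_p(E_{p²}[N])` of the genuine Tate curve `E_{p²}/ℚ_p`

Mochizuki, *The étale theta function …*, Publ. RIMS **45** (2009) [EtTh], §1, PRIMS PDF p. 13: "`K_N := K(ζ_N, q_X^{1/N})`",
"`G_{K_N}` acts trivially on `(Δ^tp_X)^ell/N·(Δ^tp_Y)^ell`" — classically, `K(ζ_N, q^{1/N})` is the field of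
`N`-torsion of the Tate curve `E_q` [cite: MochizukiEtTh2009, §1 p.13]; J. Silverman, *Advanced Topics in the
Arithmetic of Elliptic Curves* (1994), proof of Prop. V.6.1 (PDF p. 411) [cite: SilvermanATAEC1994, proof of Prop. V.6.1 (PDF p. 411)].
abc-iut cell, layer L2, seat abc-iut-L2-t5 (gen 6; Tate-curve / Kummer lineage), R78 cluster STAGE 2 — PROOF-ONLY
junction of two landed files of this lineage: `mem_GKNq_iff` (F5q `SettingModelTateTheta`: at `q_X = p²`,
`σ ∈ G_{K_N} ↔ χ_N(σ) = 1 ∧ κ_p(σ)² ≡ 0 (N)`) and `mem_ker_galoisRepTorsion_tateCurve_iff_chi_kappaP` (F3d-2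
`SettingModelKummerCocyclePTate`: `σ` acts trivially on `E_{p²}[N](ℚ̄_p)` iff the same condition). Consequence — the
first kernel link between the SEMI-SYNTHETIC stage-2 model and a GENUINE elliptic curve:

* **`mem_fixingSubgroup_fieldKN_qModel_iff_mem_ker_galoisRepTorsion`** — `G_{K_N}` (with `K = ℚ_p`, `q_X = p²`) is the
  kernel of the mod-`N` Galois representation `G_{ℚ_p} → Aut E_{p²}[N](ℚ̄_p)` of the Tate curve `tateCurve (p²)`;
* **`mem_GKN_modelTate_iff`**, `mem_GKN_modelχq_iff` — the same for the record field `(ThetaSetting.modelTate p).GKN N`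
  (and every `modelχq p i j hj`, whose `K`/`q_X` are the same): the model's `K_N` is the `N`-division field of `E_{p²}`.

HONEST LABEL: classical Kummer/Tate theory (the identification `K(ζ_N, q^{1/N}) = K(E_q[N])`); the model remains
consistency evidence only; nothing of [EtTh] is asserted; nothing here bears on [IUTchIII] Cor. 3.12. PROOF-ONLY.
-/

noncomputable section

namespace Literature.AnabelianGeometry.EtaleTheta.SettingModel

open Literature.AnabelianGeometry.SemiGraphs (GQp)
open Literature.NumberTheory.EllipticCurves Literature.NumberTheory.EllipticCurves.TateCurve
open Literature.NumberTheory.EllipticCurves.SteinWuthrich2013 (tateCurve)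
open WeierstrassCurve Field

variable (p : ℕ) [Fact p.Prime]

/-- **`G_{K_N} = Ker(G_{ℚ_p} → Aut E_{p²}[N](ℚ̄_p))`** for `K_N = ℚ_p(μ_N, (p²)^{1/N})`: the stage-2 model's covering
field `K_N` is the `N`-division field of the genuine Tate curve `E_{p²}/ℚ_p` (both memberships are
«`χ_N(σ) = 1 ∧ κ_p(σ)² ≡ 0 (N)`»). [cite: MochizukiEtTh2009, §1 p.13] -/
theorem mem_fixingSubgroup_fieldKN_qModel_iff_mem_ker_galoisRepTorsion (σ : GQp p) (N : ℕ+) :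
    σ ∈ (fieldKN ⊥ (qModel p) N).fixingSubgroup ↔
      (absoluteGaloisGroup.toAlgEquiv ℚ_[p]).symm σ ∈
        (galoisRepTorsion (tateCurve ((((p : ℕ) : ℚ_[p]) ^ 2 : ℚ_[p]))) ((N : ℕ) : ℤ)).ker := by
  rw [mem_GKNq_iff, mem_ker_galoisRepTorsion_tateCurve_iff_chi_kappaP]

/-- **The record form at the Tate instance**: `G_{K_N}` of `ThetaSetting.modelTate p` (= `modelχq p 1 2`) is the
kernel of the mod-`N` Galois representation of `E_{p²}/ℚ_p`. [cite: MochizukiEtTh2009, §1 p.13] -/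
theorem mem_GKN_modelTate_iff (σ : GQp p) (N : ℕ+) :
    σ ∈ (ThetaSetting.modelTate p).GKN N ↔
      (absoluteGaloisGroup.toAlgEquiv ℚ_[p]).symm σ ∈
        (galoisRepTorsion (tateCurve ((((p : ℕ) : ℚ_[p]) ^ 2 : ℚ_[p]))) ((N : ℕ) : ℤ)).ker :=
  mem_fixingSubgroup_fieldKN_qModel_iff_mem_ker_galoisRepTorsion p σ N

/-- The same for every stage-2 record `modelχq p i j hj` (all share `K = ℚ_p`, `q_X = p²`).
[cite: MochizukiEtTh2009, §1 p.13] -/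
theorem mem_GKN_modelχq_iff (i j : ℤ) (hj : Even j) (σ : GQp p) (N : ℕ+) :
    σ ∈ (ThetaSetting.modelχq p i j hj).GKN N ↔
      (absoluteGaloisGroup.toAlgEquiv ℚ_[p]).symm σ ∈
        (galoisRepTorsion (tateCurve ((((p : ℕ) : ℚ_[p]) ^ 2 : ℚ_[p]))) ((N : ℕ) : ℤ)).ker :=
  mem_fixingSubgroup_fieldKN_qModel_iff_mem_ker_galoisRepTorsion p σ N

/-- **`G_K̈ = G_{K_2} = G_{ℚ_p}` acts trivially on `E_{p²}[2]`** (the `2`-torsion of `E_{p²}` is `ℚ_p`-rational: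
`K̈ = K_2 = ℚ_p`). [cite: MochizukiEtTh2009, §1 p.17] -/
theorem mem_ker_galoisRepTorsion_tateCurve_two (σ : GQp p) :
    (absoluteGaloisGroup.toAlgEquiv ℚ_[p]).symm σ ∈
      (galoisRepTorsion (tateCurve ((((p : ℕ) : ℚ_[p]) ^ 2 : ℚ_[p]))) (((2 : ℕ+) : ℕ) : ℤ)).ker := by
  rw [← mem_fixingSubgroup_fieldKN_qModel_iff_mem_ker_galoisRepTorsion, fixingSubgroup_fieldKN_qModel_two_eq_top]
  exact Subgroup.mem_top σ

end Literature.AnabelianGeometry.EtaleTheta.SettingModel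

end
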